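import Summits.BirchSwinnertonDyer.BirchSwinnertonDyer.Theorems.CyclotomicUntwistGNineLeaves
import HarnessLib

/-!
# (G₉) leaves, part 2: the type-IV family (`v₃(Δ) = 6`, wild)

Second leaf file (theorems only, no definitions, no named fact) for the FIRST LEMMA `GNineCriterion`
of route `CyclotomicUntwist` (crux `PSRankOneLowerHalfAtThree`, item stmt-BirchSwinnertonDyer-21580,
registered line `birth`, stub `stub_gNineCriterion`); companion of
`CyclotomicUntwistGNineLeaves.lean` (same setting and method: `ϖ = 1 − ζ₉`, `ϖ⁶ = −3θ`, explicit
change of variables, identities `(coefficient)·θᵏ = uᵐ·y` certified by `linear_combination`,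
unit discriminant `16·D`, `D ≡ 1 (mod 3)` from the square condition).

* `hasGoodReductionAt_leafIV` — Kodaira type IV at `3` with `v₃(Δ) = 6` and square discriminant:
  `(A₂, A₄, A₆) = (9α, 9(3β₁ − 1), 9(3γ₁ + g))`, `g = ±1`: `x = ϖ⁶x' − gϖ⁴ζ`, `y = ϖ⁹y'`
  (Kraus: `v(Δ) ≡ 2 (mod 4) ⇒ Φ ≅ C₆`, good reduction over the sextic field `ℚ₃(ζ₉)`).

References: J. Tate, *Algorithm for determining the type of a singular fiber* (Antwerp IV, 1975);
A. Kraus, Manuscripta Math. 69 (1990) 353–385; J. H. Silverman, *AEC* VII.1, VII.5.1.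
-/

set_option linter.dupNamespace false

noncomputable section

open scoped NumberField Polynomial

open WeierstrassCurve IsDedekindDomain NumberField Polynomial

namespace Summit.BirchSwinnertonDyer.BirchSwinnertonDyer.Theorems.GNine

variable {F : Type*} [Field F] [NumberField F] {ζ : F} (w : HeightOneSpectrum (𝓞 F))

/-- **Leaf IV** (`v₃(Δ) = 6` wild, Kraus `Φ ≅ C₆`). For integers `α β₁ γ₁` and `g = ±1`, the cubic
`y² = x³ + 9αx² + 9(3β₁ − 1)x + 9(3γ₁ + g)` acquires good reduction at every `w ∋ 3` of a number
field containing `ζ₉`: `x = ϖ⁶x' − gϖ⁴ζ`, `y = ϖ⁹y'` (`ζ = 1 − ϖ`). [folklore] -/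
theorem hasGoodReductionAt_leafIV (hζ : IsPrimitiveRoot ζ 9) (hw : (3 : 𝓞 F) ∈ w.asIdeal)
    (α β₁ γ₁ g : ℤ) (hg : g ^ 2 = 1) :
    (⟨0, ((9 * α : ℤ) : F), 0, ((9 * (3 * β₁ - 1) : ℤ) : F), ((9 * (3 * γ₁ + g) : ℤ) : F)⟩ :
      WeierstrassCurve F).HasGoodReductionAt w := by
  have hϖ0 : (1 : F) - ζ ≠ 0 := one_sub_zeta_ne_zero hζ
  have h6 := varpi_pow_six hζ
  have hθ1 := val_theta_eq_one w hw hζ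
  have hϖv := val_one_sub_zeta_le_one w hζ
  have hgF : (g : F) ^ 2 = 1 := by exact_mod_cast hg
  generalize (1 : F) - ζ = ϖ at hϖ0 h6 hθ1 hϖv
  have hu : ϖ ^ 3 ≠ 0 := pow_ne_zero _ hϖ0
  have h36 : ϖ ^ 36 = 729 * (1 - 3 * ϖ + 6 * ϖ ^ 2 - 7 * ϖ ^ 3 + 5 * ϖ ^ 4 - 2 * ϖ ^ 5) ^ 6 := by
    linear_combination (ϖ ^ 30 - 3 * (1 - 3 * ϖ + 6 * ϖ ^ 2 - 7 * ϖ ^ 3 + 5 * ϖ ^ 4 - 2 * ϖ ^ 5) * ϖ ^ 24 + 9 * (1 - 3 * ϖ + 6 * ϖ ^ 2 - 7 * ϖ ^ 3 + 5 * ϖ ^ 4 - 2 * ϖ ^ 5) ^ 2 * ϖ ^ 18 - 27 * (1 - 3 * ϖ + 6 * ϖ ^ 2 - 7 * ϖ ^ 3 + 5 * ϖ ^ 4 - 2 * ϖ ^ 5) ^ 3 * ϖ ^ 12 + 81 * (1 - 3 * ϖ + 6 * ϖ ^ 2 - 7 * ϖ ^ 3 + 5 * ϖ ^ 4 - 2 *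 ϖ ^ 5) ^ 4 * ϖ ^ 6 - 243 * (1 - 3 * ϖ + 6 * ϖ ^ 2 - 7 * ϖ ^ 3 + 5 * ϖ ^ 4 - 2 * ϖ ^ 5) ^ 5) * h6
  push_cast
  refine hasGoodReductionAt_cubic_of_model w (ϖ ^ 3) hu (-(g : F) * ϖ ^ 4 * (1 - ϖ)) _ _ _ ?_ ?_ ?_ ?_
  · -- coefficient `2`: `(…)·θ^2 = u^2·y`, `y ∈ ℤ[ϖ]`
    refine val_le_one_of_mul_unit_pow w hθ1 2
      (y := (((1 : ℤ) : F) * ϖ ^ 4 * (g : F) + ((-4 : ℤ) : F) * ϖ ^ 5 * (g : F)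
            + ((1 : ℤ) : F) * ϖ ^ 6 * (α : F) + ((9 : ℤ) : F) * ϖ ^ 6 * (g : F)
            + ((-13 : ℤ) : F) * ϖ ^ 7 * (g : F) + ((12 : ℤ) : F) * ϖ ^ 8 * (g : F)
            + ((-7 : ℤ) : F) * ϖ ^ 9 * (g : F) + ((2 : ℤ) : F) * ϖ ^ 10 * (g : F))) ?_ ?_
    · refine scale_mul_eq hu 2 ?_
      push_cast
      linear_combination (((3 : F) * (α : F) + (-9 : F) * ϖ * (α : F) + (18 : F) * ϖ ^ 2 * (α : F)
        + (-21 : F) * ϖ ^ 3 * (α : F) + (15 : F) * ϖ ^ 4 * (α : F) + (-1 : F) * ϖ ^ 4 * (g : F)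
        + (-6 : F) * ϖ ^ 5 * (α : F) + (4 : F) * ϖ ^ 5 * (g : F) + (-1 : F) * ϖ ^ 6 * (α : F)
        + (-9 : F) * ϖ ^ 6 * (g : F) + (13 : F) * ϖ ^ 7 * (g : F) + (-12 : F) * ϖ ^ 8 * (g : F)
        + (7 : F) * ϖ ^ 9 * (g : F) + (-2 : F) * ϖ ^ 10 * (g : F))) * h6
        + ((0 : F)) * hgF
    · have e : (((1 : ℤ) : F) * ϖ ^ 4 * (g : F) + ((-4 : ℤ) : F) * ϖ ^ 5 * (g : F)
          + ((1 : ℤ) : F) * ϖ ^ 6 * (α : F) + ((9 : ℤ) : F) * ϖ ^ 6 * (g : F)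
          + ((-13 : ℤ) : F) * ϖ ^ 7 * (g : F) + ((12 : ℤ) : F) * ϖ ^ 8 * (g : F)
          + ((-7 : ℤ) : F) * ϖ ^ 9 * (g : F) + ((2 : ℤ) : F) * ϖ ^ 10 * (g : F)) =
          aeval ϖ ((((1 : ℤ) : ℤ[X]) * X ^ 4 * (g : ℤ[X]) + ((-4 : ℤ) : ℤ[X]) * X ^ 5 * (g : ℤ[X])
            + ((1 : ℤ) : ℤ[X]) * X ^ 6 * (α : ℤ[X]) + ((9 : ℤ) : ℤ[X]) * X ^ 6 * (g : ℤ[X])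
            + ((-13 : ℤ) : ℤ[X]) * X ^ 7 * (g : ℤ[X]) + ((12 : ℤ) : ℤ[X]) * X ^ 8 * (g : ℤ[X])
            + ((-7 : ℤ) : ℤ[X]) * X ^ 9 * (g : ℤ[X]) + ((2 : ℤ) : ℤ[X]) * X ^ 10 * (g : ℤ[X])) : ℤ[X]) := by
        simp only [map_add, map_mul, map_pow, aeval_X, map_intCast]
      rw [e]; exact val_aeval_le_one_of_val_le_one w hϖv _
  · -- coefficient `4`: `(…)·θ^2 = u^4·y`, `y ∈ ℤ[ϖ]`
    refine val_le_one_of_mul_unit_pow w hθ1 2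
      (y := (((-1 : ℤ) : F) + ((3 : ℤ) : F) * (β₁ : F) + ((-1 : ℤ) : F) * ϖ ^ 2
            + ((5 : ℤ) : F) * ϖ ^ 3 + ((-13 : ℤ) : F) * ϖ ^ 4
            + ((-2 : ℤ) : F) * ϖ ^ 4 * (g : F) * (α : F) + ((22 : ℤ) : F) * ϖ ^ 5
            + ((2 : ℤ) : F) * ϖ ^ 5 * (g : F) * (α : F) + ((-25 : ℤ) : F) * ϖ ^ 6
            + ((19 : ℤ) : F) * ϖ ^ 7 + ((-9 : ℤ) : F) * ϖ ^ 8 + ((2 : ℤ) : F) * ϖ ^ 9)) ?_ ?_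
    · refine scale_mul_eq hu 4 ?_
      push_cast
      linear_combination (((-3 : F) + (9 : F) * (β₁ : F) + (9 : F) * ϖ + (-27 : F) * ϖ * (β₁ : F)
        + (-18 : F) * ϖ ^ 2 + (54 : F) * ϖ ^ 2 * (β₁ : F) + (21 : F) * ϖ ^ 3
        + (-63 : F) * ϖ ^ 3 * (β₁ : F) + (-15 : F) * ϖ ^ 4 + (45 : F) * ϖ ^ 4 * (β₁ : F)
        + (-6 : F) * ϖ ^ 4 * (g : F) * (α : F) + (6 : F) * ϖ ^ 5 + (-18 : F) * ϖ ^ 5 * (β₁ : F)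
        + (24 : F) * ϖ ^ 5 * (g : F) * (α : F) + (1 : F) * ϖ ^ 6 + (-3 : F) * ϖ ^ 6 * (β₁ : F)
        + (-54 : F) * ϖ ^ 6 * (g : F) * (α : F) + (78 : F) * ϖ ^ 7 * (g : F) * (α : F)
        + (1 : F) * ϖ ^ 8 + (-72 : F) * ϖ ^ 8 * (g : F) * (α : F) + (-5 : F) * ϖ ^ 9
        + (42 : F) * ϖ ^ 9 * (g : F) * (α : F) + (13 : F) * ϖ ^ 10
        + (-10 : F) * ϖ ^ 10 * (g : F) * (α : F) + (-22 : F) * ϖ ^ 11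
        + (-2 : F) * ϖ ^ 11 * (g : F) * (α : F) + (25 : F) * ϖ ^ 12 + (-19 : F) * ϖ ^ 13
        + (9 : F) * ϖ ^ 14 + (-2 : F) * ϖ ^ 15)) * h6
        + (((3 : F) * ϖ ^ 8 + (-24 : F) * ϖ ^ 9 + (102 : F) * ϖ ^ 10 + (-294 : F) * ϖ ^ 11
          + (627 : F) * ϖ ^ 12 + (-1032 : F) * ϖ ^ 13 + (1335 : F) * ϖ ^ 14 + (-1362 : F) * ϖ ^ 15
          + (1086 : F) * ϖ ^ 16 + (-660 : F) * ϖ ^ 17 + (291 : F) * ϖ ^ 18 + (-84 : F) * ϖ ^ 19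
          + (12 : F) * ϖ ^ 20)) * hgF
    · have e : (((-1 : ℤ) : F) + ((3 : ℤ) : F) * (β₁ : F) + ((-1 : ℤ) : F) * ϖ ^ 2
          + ((5 : ℤ) : F) * ϖ ^ 3 + ((-13 : ℤ) : F) * ϖ ^ 4
          + ((-2 : ℤ) : F) * ϖ ^ 4 * (g : F) * (α : F) + ((22 : ℤ) : F) * ϖ ^ 5
          + ((2 : ℤ) : F) * ϖ ^ 5 * (g : F) * (α : F) + ((-25 : ℤ) : F) * ϖ ^ 6
          + ((19 : ℤ) : F) * ϖ ^ 7 + ((-9 : ℤ) : F) * ϖ ^ 8 + ((2 : ℤ) : F) * ϖ ^ 9) =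
          aeval ϖ ((((-1 : ℤ) : ℤ[X]) + ((3 : ℤ) : ℤ[X]) * (β₁ : ℤ[X]) + ((-1 : ℤ) : ℤ[X]) * X ^ 2
            + ((5 : ℤ) : ℤ[X]) * X ^ 3 + ((-13 : ℤ) : ℤ[X]) * X ^ 4
            + ((-2 : ℤ) : ℤ[X]) * X ^ 4 * (g : ℤ[X]) * (α : ℤ[X]) + ((22 : ℤ) : ℤ[X]) * X ^ 5
            + ((2 : ℤ) : ℤ[X]) * X ^ 5 * (g : ℤ[X]) * (α : ℤ[X]) + ((-25 : ℤ) : ℤ[X]) * X ^ 6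
            + ((19 : ℤ) : ℤ[X]) * X ^ 7 + ((-9 : ℤ) : ℤ[X]) * X ^ 8 + ((2 : ℤ) : ℤ[X]) * X ^ 9) : ℤ[X]) := by
        simp only [map_add, map_mul, map_pow, aeval_X, map_intCast]
      rw [e]; exact val_aeval_le_one_of_val_le_one w hϖv _
  · -- coefficient `6`: `(…)·θ^3 = u^6·y`, `y ∈ ℤ[ϖ]`
    refine val_le_one_of_mul_unit_pow w hθ1 3
      (y := (((-1 : ℤ) : F) * (γ₁ : F) + ((-789 : ℤ) : F) * (g : F)
            + ((3263 : ℤ) : F) * ϖ * (g : F) + ((1 : ℤ) : F) * ϖ ^ 2 * (α : F)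
            + ((-8233 : ℤ) : F) * ϖ ^ 2 * (g : F) + ((-5 : ℤ) : F) * ϖ ^ 3 * (α : F)
            + ((13903 : ℤ) : F) * ϖ ^ 3 * (g : F) + ((13 : ℤ) : F) * ϖ ^ 4 * (α : F)
            + ((-17095 : ℤ) : F) * ϖ ^ 4 * (g : F) + ((1 : ℤ) : F) * ϖ ^ 4 * (g : F) * (β₁ : F)
            + ((-22 : ℤ) : F) * ϖ ^ 5 * (α : F) + ((16169 : ℤ) : F) * ϖ ^ 5 * (g : F)
            + ((-1 : ℤ) : F) * ϖ ^ 5 * (g : F) * (β₁ : F) + ((25 : ℤ) : F) * ϖ ^ 6 * (α : F)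
            + ((-12261 : ℤ) : F) * ϖ ^ 6 * (g : F) + ((-19 : ℤ) : F) * ϖ ^ 7 * (α : F)
            + ((7611 : ℤ) : F) * ϖ ^ 7 * (g : F) + ((9 : ℤ) : F) * ϖ ^ 8 * (α : F)
            + ((-3828 : ℤ) : F) * ϖ ^ 8 * (g : F) + ((-2 : ℤ) : F) * ϖ ^ 9 * (α : F)
            + ((1507 : ℤ) : F) * ϖ ^ 9 * (g : F) + ((-438 : ℤ) : F) * ϖ ^ 10 * (g : F)
            + ((84 : ℤ) : F) * ϖ ^ 11 * (g : F) + ((-8 : ℤ) : F) * ϖ ^ 12 * (g : F))) ?_ ?_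
    · refine scale_mul_eq hu 6 ?_
      push_cast
      linear_combination (((9 : F) * (γ₁ : F) + (3 : F) * (g : F) + (-54 : F) * ϖ * (γ₁ : F)
        + (-18 : F) * ϖ * (g : F) + (189 : F) * ϖ ^ 2 * (γ₁ : F) + (63 : F) * ϖ ^ 2 * (g : F)
        + (-450 : F) * ϖ ^ 3 * (γ₁ : F) + (-150 : F) * ϖ ^ 3 * (g : F)
        + (792 : F) * ϖ ^ 4 * (γ₁ : F) + (267 : F) * ϖ ^ 4 * (g : F)
        + (-9 : F) * ϖ ^ 4 * (g : F) * (β₁ : F) + (-1062 : F) * ϖ ^ 5 * (γ₁ : F)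
        + (-375 : F) * ϖ ^ 5 * (g : F) + (63 : F) * ϖ ^ 5 * (g : F) * (β₁ : F)
        + (1086 : F) * ϖ ^ 6 * (γ₁ : F) + (443 : F) * ϖ ^ 6 * (g : F)
        + (-243 : F) * ϖ ^ 6 * (g : F) * (β₁ : F) + (-837 : F) * ϖ ^ 7 * (γ₁ : F)
        + (-492 : F) * ϖ ^ 7 * (g : F) + (639 : F) * ϖ ^ 7 * (g : F) * (β₁ : F)
        + (459 : F) * ϖ ^ 8 * (γ₁ : F) + (3 : F) * ϖ ^ 8 * (α : F) + (567 : F) * ϖ ^ 8 * (g : F)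
        + (-1242 : F) * ϖ ^ 8 * (g : F) * (β₁ : F) + (-159 : F) * ϖ ^ 9 * (γ₁ : F)
        + (-24 : F) * ϖ ^ 9 * (α : F) + (-671 : F) * ϖ ^ 9 * (g : F)
        + (1854 : F) * ϖ ^ 9 * (g : F) * (β₁ : F) + (21 : F) * ϖ ^ 10 * (γ₁ : F)
        + (102 : F) * ϖ ^ 10 * (α : F) + (723 : F) * ϖ ^ 10 * (g : F)
        + (-2148 : F) * ϖ ^ 10 * (g : F) * (β₁ : F) + (6 : F) * ϖ ^ 11 * (γ₁ : F)
        + (-294 : F) * ϖ ^ 11 * (α : F) + (-639 : F) * ϖ ^ 11 * (g : F)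
        + (1923 : F) * ϖ ^ 11 * (g : F) * (β₁ : F) + (1 : F) * ϖ ^ 12 * (γ₁ : F)
        + (627 : F) * ϖ ^ 12 * (α : F) + (432 : F) * ϖ ^ 12 * (g : F)
        + (-1296 : F) * ϖ ^ 12 * (g : F) * (β₁ : F) + (-1032 : F) * ϖ ^ 13 * (α : F)
        + (-203 : F) * ϖ ^ 13 * (g : F) + (618 : F) * ϖ ^ 13 * (g : F) * (β₁ : F)
        + (1334 : F) * ϖ ^ 14 * (α : F) + (46 : F) * ϖ ^ 14 * (g : F)
        + (-180 : F) * ϖ ^ 14 * (g : F) * (β₁ : F) + (-1357 : F) * ϖ ^ 15 * (α : F)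
        + (39 : F) * ϖ ^ 15 * (g : F) + (15 : F) * ϖ ^ 15 * (g : F) * (β₁ : F)
        + (1073 : F) * ϖ ^ 16 * (α : F) + (-104 : F) * ϖ ^ 16 * (g : F)
        + (5 : F) * ϖ ^ 16 * (g : F) * (β₁ : F) + (-638 : F) * ϖ ^ 17 * (α : F)
        + (184 : F) * ϖ ^ 17 * (g : F) + (1 : F) * ϖ ^ 17 * (g : F) * (β₁ : F)
        + (266 : F) * ϖ ^ 18 * (α : F) + (-65 : F) * ϖ ^ 19 * (α : F) + (3 : F) * ϖ ^ 20 * (α : F)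
        + (2 : F) * ϖ ^ 21 * (α : F))) * h6
        + (((9 : F) * ϖ ^ 8 * (α : F) + (-99 : F) * ϖ ^ 9 * (α : F) + (576 : F) * ϖ ^ 10 * (α : F)
          + (-2295 : F) * ϖ ^ 11 * (α : F) + (6912 : F) * ϖ ^ 12 * (α : F)
          + (-1 : F) * ϖ ^ 12 * (g : F) + (-16551 : F) * ϖ ^ 13 * (α : F)
          + (12 : F) * ϖ ^ 13 * (g : F) + (32427 : F) * ϖ ^ 14 * (α : F)
          + (-75 : F) * ϖ ^ 14 * (g : F) + (-52866 : F) * ϖ ^ 15 * (α : F)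
          + (319 : F) * ϖ ^ 15 * (g : F) + (72387 : F) * ϖ ^ 16 * (α : F)
          + (-1023 : F) * ϖ ^ 16 * (g : F) + (-83547 : F) * ϖ ^ 17 * (α : F)
          + (2607 : F) * ϖ ^ 17 * (g : F) + (81180 : F) * ϖ ^ 18 * (α : F)
          + (-5442 : F) * ϖ ^ 18 * (g : F) + (-65997 : F) * ϖ ^ 19 * (α : F)
          + (9477 : F) * ϖ ^ 19 * (g : F) + (44352 : F) * ϖ ^ 20 * (α : F)
          + (-13917 : F) * ϖ ^ 20 * (g : F) + (-24147 : F) * ϖ ^ 21 * (α : F)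
          + (17326 : F) * ϖ ^ 21 * (g : F) + (10305 : F) * ϖ ^ 22 * (α : F)
          + (-18303 : F) * ϖ ^ 22 * (g : F) + (-3258 : F) * ϖ ^ 23 * (α : F)
          + (16353 : F) * ϖ ^ 23 * (g : F) + (684 : F) * ϖ ^ 24 * (α : F)
          + (-12261 : F) * ϖ ^ 24 * (g : F) + (-72 : F) * ϖ ^ 25 * (α : F)
          + (7611 : F) * ϖ ^ 25 * (g : F) + (-3828 : F) * ϖ ^ 26 * (g : F)
          + (1507 : F) * ϖ ^ 27 * (g : F) + (-438 : F) * ϖ ^ 28 * (g : F)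
          + (84 : F) * ϖ ^ 29 * (g : F) + (-8 : F) * ϖ ^ 30 * (g : F))) * hgF
    · have e : (((-1 : ℤ) : F) * (γ₁ : F) + ((-789 : ℤ) : F) * (g : F) + ((3263 : ℤ) : F) * ϖ * (g : F)
          + ((1 : ℤ) : F) * ϖ ^ 2 * (α : F) + ((-8233 : ℤ) : F) * ϖ ^ 2 * (g : F)
          + ((-5 : ℤ) : F) * ϖ ^ 3 * (α : F) + ((13903 : ℤ) : F) * ϖ ^ 3 * (g : F)
          + ((13 : ℤ) : F) * ϖ ^ 4 * (α : F) + ((-17095 : ℤ) : F) * ϖ ^ 4 * (g : F)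
          + ((1 : ℤ) : F) * ϖ ^ 4 * (g : F) * (β₁ : F) + ((-22 : ℤ) : F) * ϖ ^ 5 * (α : F)
          + ((16169 : ℤ) : F) * ϖ ^ 5 * (g : F) + ((-1 : ℤ) : F) * ϖ ^ 5 * (g : F) * (β₁ : F)
          + ((25 : ℤ) : F) * ϖ ^ 6 * (α : F) + ((-12261 : ℤ) : F) * ϖ ^ 6 * (g : F)
          + ((-19 : ℤ) : F) * ϖ ^ 7 * (α : F) + ((7611 : ℤ) : F) * ϖ ^ 7 * (g : F)
          + ((9 : ℤ) : F) * ϖ ^ 8 * (α : F) + ((-3828 : ℤ) : F) * ϖ ^ 8 * (g : F)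
          + ((-2 : ℤ) : F) * ϖ ^ 9 * (α : F) + ((1507 : ℤ) : F) * ϖ ^ 9 * (g : F)
          + ((-438 : ℤ) : F) * ϖ ^ 10 * (g : F) + ((84 : ℤ) : F) * ϖ ^ 11 * (g : F)
          + ((-8 : ℤ) : F) * ϖ ^ 12 * (g : F)) =
          aeval ϖ ((((-1 : ℤ) : ℤ[X]) * (γ₁ : ℤ[X]) + ((-789 : ℤ) : ℤ[X]) * (g : ℤ[X])
            + ((3263 : ℤ) : ℤ[X]) * X * (g : ℤ[X]) + ((1 : ℤ) : ℤ[X]) * X ^ 2 * (α : ℤ[X])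
            + ((-8233 : ℤ) : ℤ[X]) * X ^ 2 * (g : ℤ[X]) + ((-5 : ℤ) : ℤ[X]) * X ^ 3 * (α : ℤ[X])
            + ((13903 : ℤ) : ℤ[X]) * X ^ 3 * (g : ℤ[X]) + ((13 : ℤ) : ℤ[X]) * X ^ 4 * (α : ℤ[X])
            + ((-17095 : ℤ) : ℤ[X]) * X ^ 4 * (g : ℤ[X])
            + ((1 : ℤ) : ℤ[X]) * X ^ 4 * (g : ℤ[X]) * (β₁ : ℤ[X])
            + ((-22 : ℤ) : ℤ[X]) * X ^ 5 * (α : ℤ[X]) + ((16169 : ℤ) : ℤ[X]) * X ^ 5 * (g : ℤ[X])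
            + ((-1 : ℤ) : ℤ[X]) * X ^ 5 * (g : ℤ[X]) * (β₁ : ℤ[X])
            + ((25 : ℤ) : ℤ[X]) * X ^ 6 * (α : ℤ[X]) + ((-12261 : ℤ) : ℤ[X]) * X ^ 6 * (g : ℤ[X])
            + ((-19 : ℤ) : ℤ[X]) * X ^ 7 * (α : ℤ[X]) + ((7611 : ℤ) : ℤ[X]) * X ^ 7 * (g : ℤ[X])
            + ((9 : ℤ) : ℤ[X]) * X ^ 8 * (α : ℤ[X]) + ((-3828 : ℤ) : ℤ[X]) * X ^ 8 * (g : ℤ[X])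
            + ((-2 : ℤ) : ℤ[X]) * X ^ 9 * (α : ℤ[X]) + ((1507 : ℤ) : ℤ[X]) * X ^ 9 * (g : ℤ[X])
            + ((-438 : ℤ) : ℤ[X]) * X ^ 10 * (g : ℤ[X]) + ((84 : ℤ) : ℤ[X]) * X ^ 11 * (g : ℤ[X])
            + ((-8 : ℤ) : ℤ[X]) * X ^ 12 * (g : ℤ[X])) : ℤ[X]) := by
        simp only [map_add, map_mul, map_pow, aeval_X, map_intCast]
      rw [e]; exact val_aeval_le_one_of_val_le_one w hϖv _
  · -- discriminant: `16Δ₀·θ^6 = u¹²·(16·D)` with `D ≡ 1 (mod 3)`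
    rw [cubic_Δ]
    refine val_eq_one_of_mul_unit_pow w hθ1 6
      (y := (((16 * ((4 : ℤ) + (-27 : ℤ) * γ₁ ^ 2 + (-36 : ℤ) * β₁ + (108 : ℤ) * β₁ ^ 2
              + (-108 : ℤ) * β₁ ^ 3 + (-54 : ℤ) * α * γ₁ + (162 : ℤ) * α * β₁ * γ₁
              + (9 : ℤ) * α ^ 2 + (-54 : ℤ) * α ^ 2 * β₁ + (81 : ℤ) * α ^ 2 * β₁ ^ 2
              + (-108 : ℤ) * α ^ 3 * γ₁ + (-18 : ℤ) * g * γ₁ + (-18 : ℤ) * g * α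
              + (54 : ℤ) * g * α * β₁ + (-36 : ℤ) * g * α ^ 3 + (-3 : ℤ) * g ^ 2) : ℤ) : ℤ) : F)) ?_ ?_
    · refine scale_mul_eq hu 12 ?_
      push_cast
      linear_combination (-(16 : F) * ((4 : F) + (-27 : F) * (γ₁ : F) ^ 2 + (-36 : F) * (β₁ : F) + (108 : F) * (β₁ : F) ^ 2
        + (-108 : F) * (β₁ : F) ^ 3 + (-54 : F) * (α : F) * (γ₁ : F)
        + (162 : F) * (α : F) * (β₁ : F) * (γ₁ : F) + (9 : F) * (α : F) ^ 2
        + (-54 : F) * (α : F) ^ 2 * (β₁ : F) + (81 : F) * (α : F) ^ 2 * (β₁ : F) ^ 2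
        + (-108 : F) * (α : F) ^ 3 * (γ₁ : F) + (-18 : F) * (g : F) * (γ₁ : F)
        + (-18 : F) * (g : F) * (α : F) + (54 : F) * (g : F) * (α : F) * (β₁ : F)
        + (-36 : F) * (g : F) * (α : F) ^ 3 + (-3 : F) * (g : F) ^ 2)) * h36
    · refine val_intCast_eq_one_of_not_dvd w hw ?_
      obtain ⟨Q, hQ⟩ : ∃ Q : ℤ, ((4 : ℤ) + (-27 : ℤ) * γ₁ ^ 2 + (-36 : ℤ) * β₁ + (108 : ℤ) * β₁ ^ 2
          + (-108 : ℤ) * β₁ ^ 3 + (-54 : ℤ) * α * γ₁ + (162 : ℤ) * α * β₁ * γ₁ + (9 : ℤ) * α ^ 2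
          + (-54 : ℤ) * α ^ 2 * β₁ + (81 : ℤ) * α ^ 2 * β₁ ^ 2 + (-108 : ℤ) * α ^ 3 * γ₁
          + (-18 : ℤ) * g * γ₁ + (-18 : ℤ) * g * α + (54 : ℤ) * g * α * β₁ + (-36 : ℤ) * g * α ^ 3
          + (-3 : ℤ) * g ^ 2) = 3 * Q + 1 :=
        ⟨((-9 : ℤ) * γ₁ ^ 2 + (-12 : ℤ) * β₁ + (36 : ℤ) * β₁ ^ 2 + (-36 : ℤ) * β₁ ^ 3
          + (-18 : ℤ) * α * γ₁ + (54 : ℤ) * α * β₁ * γ₁ + (3 : ℤ) * α ^ 2 + (-18 : ℤ) * α ^ 2 * β₁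
          + (27 : ℤ) * α ^ 2 * β₁ ^ 2 + (-36 : ℤ) * α ^ 3 * γ₁ + (-6 : ℤ) * g * γ₁
          + (-6 : ℤ) * g * α + (18 : ℤ) * g * α * β₁ + (-12 : ℤ) * g * α ^ 3), by linear_combination (((-3 : ℤ))) * hg⟩
      rw [hQ]; omega

end Summit.BirchSwinnertonDyer.BirchSwinnertonDyer.Theorems.GNine

end
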